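import Literature.MathematicalPhysics.QuantumFieldTheory.Balaban1983to89.B9Eq327GreenZdHermPer
import Literature.MathematicalPhysics.QuantumFieldTheory.Balaban1983to89.B9Eq326DeltaAHermitianZdCurved

/-!
# `Balaban1983to89.B9Eq326DeltaAPeriodicLettersZd` — [Balaban1985BackgroundPropagators] (3.10) `Δ′(U)` and (3.16) `Q*aQ` ON THE TORUS `T_η` READ ON
# `ℤᵈ`: the GENUINE letters `Δ′ = DpZd` (dag-n06-w2) and `Q*aQ = QQZdP` (this lineage) of the J-N06→N05 junction record are TRANSLATION COVARIANT,
# hence map `P`-periodic data to `P`-periodic fields; with their Hermiticity (`star_DpZd`, `isSelfAdjoint_QQZdP_of_box`) they preserve the periodic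
# Hermitian carrier `E_𝔤^per(P)` of `B9Eq327GreenZdHermPer` — the letter half of the (β′-PERIODIC) road's `PerPreservingAt`

statement-level skeleton of published theorems with citation tags; proofs where landed; nothing here is a claim about the
Yang–Mills mass gap

`[Balaban1985BackgroundPropagators]` ("B9", CMP **99** (1985) 389–434): (3.1)–(3.4) p. 390–391 (bond variables, transporters `R(U)`, the plaquette
derivative), (3.9)–(3.10) p. 392 (*«Δ = D*D + Δ′ … the operator Δ′ will be a bounded, small operator»*), (3.14)–(3.16) p. 393 (*«an operator Q*aQ»*,
the averaging `Q_j`), (3.26) p. 395.  `[Balaban1985RegularSpaces]` ("B8") p. 77 (*«we admit the case when some domains Ω_j are equal to T_η»*), (1.7)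
p. 77, (1.31) p. 82 (box law), (1.56), (1.58) p. 86.  `[Balaban1985Averaging]` ("B7") (127) p. 37, (147), (150) p. 40 (the composite linearised average
and its translation covariance), p. 24.  `[Balaban1987RG1]` (4.16) p. 285 (translation covariance on the lattice).

CITATION HEADER ∕ WHY THIS FILE (cell `pub-ymgap`, HUMAN RULING D-0062; node N06 = [B9]; seat `pub-ymgap-dag-n06-b` (g22), junction ∕ letter lineage
J-N06→N05).  The (β′-PERIODIC) road (director-ym №217, plan PENS-217) reads print's torus `T_η` as `P`-periodic data on `ℤᵈ` with `Ω 0 = univ`.  FILE 1 of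
this seat (`B9Eq327GreenZdHermPer`, p638598) built the propagator `G_𝔤^per(U₀)` on the periodic Hermitian carrier `E_𝔤^per(P)` and reduced its
existence (`RegularAtHPer`) to positivity PLUS the structural `PerPreservingAt η o P U₀` («`Δ_a(U₀)` maps `E_𝔤^per(P)` into itself»), inhabited there
only for the one-level record.  THIS FILE proves the translation covariance of the two GENUINE local letters of the four-letter record `opsAllZd` —
`Δ′(U₀) = B9Eq369CurvSmallZd.DpZd` (lit-balaban's abstract `B9Eq310Hermitian.deltaPrimeOp` on the `ℤᵈ` shift structure) and
`Q*aQ = B9Eq316AveragingTransposeZdPrinted.QQZdP` (EDITION P) — and assembles `PerPreservingAt` for any record carrying them, GIVEN the same property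
of its `DRD*` letter (the periodic Landau projection is a separate object: dag-n06-w4's `projE ∕ opsLandau` lineage or a later file of this seat).
The class-periodicity currency is dag-n05-w2's (`B8IdxB8SubDPeriodicTowers.IdxB8SubD.isPeriodic_Λb_of_dvd`: the level-`j` bond class is
`(P ∕ Lʲ)`-periodic in its coarse coordinate when the domains are `P`-periodic and `Lᵐ ∣ P`).

WHAT IS PROVED (kernel, 0 sorry; theorems only — no `def`, no `instance`, no `notation`).
* §1 `Δ′`: ★ `deltaPrimeOp_comp` (lit-balaban's abstract `deltaPrimeOp T U η A` is EQUIVARIANT under every lattice map `σ` commuting with the shifts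
  `T κ` and their inverses: `Δ′_{U∘σ}(A∘σ)(μ, x) = Δ′_U(A)(μ, σ x)` — one `simp only` through `divP ∕ divL ∕ covDstar ∕ jordanF ∕ commGᵢ ∕ sgnSumᵢ ∕ zP ∕
  yP ∕ plaqU ∕ curl ∕ covD`), ★ `DpZd_shiftCfg` (`DpZd η (shiftCfg u U₀) (shiftCfg u A) x μ = DpZd η U₀ A (x + u) μ`), ★ `isPeriodic_DpZd`,
  ★ `DpZd_mem_domSubHPer` (periodic unitary `U₀`, `A ∈ E_𝔤^per(P)` ⟹ `Δ′(U₀)A ∈ E_𝔤^per(P)`; Hermiticity = `B9Eq326DeltaAHermitianZd.star_DpZd`).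
* §2 `Q*aQ`: `shiftCfg_eq_self_of_isPeriodic`, `shiftCfg_bump`, `iEta_shiftCfg`, `isPeriodic_iEta`, `winBase_add_pow_mul_smul` (the window base of the
  transpose moves by `Q•n` when the fine site moves by `(Lʲ·Q)•n`), ★ `linCovIter_add_period` (via `B7TranslationCovariance.linCovIter_shiftCfg`),
  ★ `linCovIterT_add_period` (the TRANSPOSE `Q_jᵀ` of [B7] (127) is `(Lʲ·Q)`-translation invariant on `Q`-periodic coarse inputs at a periodic
  background), ★ `isPeriodic_clsField`, ★★ `QQZdP_add_period` ∕ ★★ `isPeriodic_QQZdP` (`1 ≤ L`, `IsPeriodic P U₀`, `IsPeriodic P A`, `Lᵐ ∣ P`,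
  `∀ j ≤ m, ∀ κ, IsPeriodic (P ∕ Lʲ) (fun z => (z, κ) ∈ ΛbP m j)`), ★ `QQZdP_mem_domSubHPer` (+ `2 ≤ L`, faithful Hermitian tracial `τ`, the box clause
  of [B8] (1.31) at levels `j ≥ 1` — Hermiticity = `B9Eq326DeltaAHermitianZdCurved.isSelfAdjoint_QQZdP_of_box`).
* §3 ASSEMBLY: `Jcur_mem_domSubHPer` (the `D*D` part, FILE 1's `isPeriodic_Jcur` + `star_Jcur`), ★ `perPreservingAt_of_letters` (ANY record: if
  `Dp ∕ DRDs ∕ QQ` map `E_𝔤^per(P)` into itself at a periodic unitary `U₀`, then `PerPreservingAt η o P U₀`), ★★ `perPreservingAt_of_DpZd_QQZdP` (a record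
  with `Dp = DpZd i.η`, `QQ = QQZdP τ L ΛbP i m` — e.g. `withDpZd (withQQP τ L ΛbP ops₀)` or `opsAllZd` — preserves `E_𝔤^per(P)` at every periodic unitary
  `U₀`, GIVEN the same for its `DRDs` letter), `perPreservingAt_withDpZd_withQQP_of_DRDs` (the record-edit reading).

HONEST SCOPE.  (i) Bookkeeping (translation covariance) + two citations of landed Hermiticity lemmas; NO estimate of [B9] ∕ [B8] ∕ [B7] is proved; Theorem
3.11 ∕ 3.3 untouched.  (ii) NOT here: the `DRD*` letter on the periodic subspace (hypothesis `hDRDs` displayed), positivity of `Δ_a(U₀)` on `E_𝔤^per(P)`,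
the periodic socket.  (iii) Count-neutral; N05 ∕ N06 NOT discharged; K1⁹ `stmt-QuantumFields-27364` NOT closed; 28∕28 · 5∕27 UNMOVED; one finite `𝕋⁴`
programme at fixed `ε`, Bałaban as printed; R4 closes only the conditional finite-`𝕋⁴` rung `BalabanLadder.UV` — nothing continuum ∕ ℝ⁴ ∕ OS ∕ mass gap ∕
Clay.  Unit `pub-ymgap-dag-n06-b` (g22), 2026-08-28.
-/

noncomputable section

namespace Literature.MathematicalPhysics.QuantumFieldTheory.Balaban1983to89.B9Eq326DeltaAPeriodicLettersZd

open B7Prop1Explicit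
open B7Prop2Explicit (unitaryUnits)
open B7Prop1Local (InBox loK bondHiK)
open B7Prop5Flat (bump)
open B7Prop4GeneralLevels (linCovIter)
open B7TranslationCovariance (linCovIter_shiftCfg)
open B8Eq133Hypotheses (shiftT byDir shiftT_apply byDir_apply)
open B8Eq146AExpansion (iEta)
open B8Eq155JBound (Jcur)
open B8LeafModelZd (ZdIdx)
open B9Eq39Adjoint (R plaqU covD covDstar curl divP)
open B9Eq310Hermitian (deltaPrimeOp divL jordanF commG₁ commG₂ commG₃ commG₄ sgnSum₁ sgnSum₂ sgnSum₃ sgnSum₄ zP yP)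
open B9Eq369CurvSmallZd (DpZd)
open B9SupplySockB9P3ZdGammaInAkDpZd (withDpZd)
open B9Eq316AveragingTransposeZd (linCovIterT winBase clsField entryT wQ Reg17 alphaQ)
open B9Eq316AveragingTransposeZdPrinted (QQZdP withQQP)
open B9Eq326DeltaAHermitianZd (star_Jcur star_DpZd)
open B9Eq326DeltaAHermitianZdCurved (isSelfAdjoint_QQZdP_of_box)
open B9SupplySockB9P3ZdLetters (OpsZd deltaAOf)
open B9Eq327GreenZdHermPer (domSubHPer PerPreservingAt isPeriodic_Jcur)
open B12Ineq417Flat (shiftCfg shiftCfg_apply)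
open T4TermwiseTorus (IsPeriodic)

-- `Site` alone could resolve to the torus sites of `Setup.lean`; re-export the `ℤ^d` sites of `B7Prop1Explicit`.
export B7Prop1Explicit (Site)

/-! ## §1  `Δ′(U)` of (3.10) is translation covariant, hence periodic-preserving -/

section DeltaPrimeAbstract

variable {𝔸 : Type*} [Ring 𝔸] [Algebra ℂ 𝔸] {S : Type*} {ι : Type*} [Fintype ι] [LinearOrder ι]
variable (T : ι → Equiv.Perm S) (U : ι → S → 𝔸ˣ)

/-- ★ **`Δ′` IS EQUIVARIANT UNDER LATTICE MAPS COMMUTING WITH THE SHIFTS**: for lit-balaban's abstract operator `deltaPrimeOp T U η A` of (3.10) on a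
lattice `S` with shift structure `T`, and any `σ : S → S` with `T κ ∘ σ = σ ∘ T κ`, `(T κ)⁻¹ ∘ σ = σ ∘ (T κ)⁻¹`: reading the background and the field through
`σ` is reading `Δ′` at `σ x` — every letter of (3.9)–(3.10) (`D*`, the letter divergence, `U(∂p)`, `Re ∕ Im U(∂p)`, the curl, the signed partner sums)
is built from `U`, `A` at iterated shifts of the base point. [cite: Balaban1985BackgroundPropagators, (3.9)–(3.10) p.392, (3.1)–(3.4) pp.390–391; Balaban1987RG1, (4.16) p.285] -/
theorem deltaPrimeOp_comp (η : ℝ) (A : ι → S → 𝔸) (σ : S → S)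
    (hσ : ∀ κ x, T κ (σ x) = σ (T κ x)) (hσ' : ∀ κ x, (T κ).symm (σ x) = σ ((T κ).symm x)) (μ : ι) (x : S) :
    deltaPrimeOp T (fun κ y => U κ (σ y)) η (fun κ y => A κ (σ y)) μ x = deltaPrimeOp T U η A μ (σ x) := by
  simp only [deltaPrimeOp, divP, divL, covDstar, jordanF, commG₁, commG₂, commG₃, commG₄, sgnSum₁, sgnSum₂, sgnSum₃, sgnSum₄,
    zP, yP, plaqU, curl, covD, hσ, hσ']

end DeltaPrimeAbstract

section DeltaPrimeZd

variable {d : ℕ} {𝔸 : Type*} [CStarAlgebra 𝔸]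

/-- ★ **THE GENUINE `Δ′(U₀)` ON `ℤᵈ` (dag-n06-w2's `DpZd`) IS TRANSLATION COVARIANT**: `Δ′(t_uU₀)(t_uA)(⟨x, x+e_μ⟩) = Δ′(U₀)(A)(⟨x+u, x+u+e_μ⟩)`.
[cite: Balaban1985BackgroundPropagators, (3.10) p.392; Balaban1987RG1, (4.16) p.285] -/
theorem DpZd_shiftCfg (η : ℝ) (u : Site d) (U₀ : Site d → Fin d → 𝔸ˣ) (A : Site d → Fin d → 𝔸) (x : Site d) (μ : Fin d) :
    DpZd η (shiftCfg u U₀) (shiftCfg u A) x μ = DpZd η U₀ A (x + u) μ := by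
  rw [B9Eq369CurvSmallZd.DpZd_apply, B9Eq369CurvSmallZd.DpZd_apply]
  have h1 : byDir (shiftCfg u U₀) = fun κ y => byDir U₀ κ (y + u) := rfl
  have h2 : byDir (shiftCfg u A) = fun κ y => byDir A κ (y + u) := rfl
  rw [h1, h2]
  exact deltaPrimeOp_comp (shiftT d) (byDir U₀) η (byDir A) (· + u)
    (fun κ y => by simp only [shiftT_apply, add_right_comm])
    (fun κ y => by
      rw [Equiv.symm_apply_eq]
      have h := (shiftT d κ).apply_symm_apply y
      rw [shiftT_apply] at h
      rw [shiftT_apply, add_right_comm, h]) μ x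

/-- ★ **`Δ′(U₀)A` OF PERIODIC DATA IS PERIODIC** (the torus `T_η` read on `ℤᵈ`). [cite: Balaban1985BackgroundPropagators, (3.10) p.392; Balaban1985RegularSpaces, p.77 («Ω_j = T_η»)] -/
theorem isPeriodic_DpZd {P : ℕ} (η : ℝ) {U₀ : Site d → Fin d → 𝔸ˣ} (hU : IsPeriodic P U₀) {A : Site d → Fin d → 𝔸} (hA : IsPeriodic P A) :
    IsPeriodic P (DpZd η U₀ A) := fun x m => by
  funext μ
  have hU' : shiftCfg ((P : ℤ) • m) U₀ = U₀ := funext fun y => hU y m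
  have hA' : shiftCfg ((P : ℤ) • m) A = A := funext fun y => hA y m
  rw [← DpZd_shiftCfg η ((P : ℤ) • m) U₀ A x μ, hU', hA']

/-- ★ **`Δ′(U₀)` MAPS `E_𝔤^per(P)` INTO ITSELF** at a periodic unitary background (periodicity above; Hermiticity = `star_DpZd`).
[cite: Balaban1985BackgroundPropagators, (3.10) p.392, p.391 («hermitian matrices»); Balaban1985RegularSpaces, p.77] -/
theorem DpZd_mem_domSubHPer {P : ℕ} (η : ℝ) {U₀ : Site d → Fin d → 𝔸ˣ} (hUu : ∀ (x : Site d) (κ : Fin d), U₀ x κ ∈ unitaryUnits 𝔸)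
    (hU : IsPeriodic P U₀) {A : Site d → Fin d → 𝔸} (hA : A ∈ domSubHPer (d := d) (𝔸 := 𝔸) P) :
    DpZd η U₀ A ∈ domSubHPer (d := d) (𝔸 := 𝔸) P := by
  refine ⟨isPeriodic_DpZd η hU hA.1, fun y τ' => ?_⟩
  have hstarA : star A = A := by
    funext z κ; exact (hA.2 z κ).star_eq
  rw [IsSelfAdjoint, star_DpZd hUu A y τ', hstarA]

end DeltaPrimeZd

/-! ## §2  `Q*aQ` of (3.16) (EDITION P) is translation covariant by the block period, hence periodic-preserving -/

section Averaging

variable {d : ℕ} {𝔸 : Type*} [CStarAlgebra 𝔸]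

omit [CStarAlgebra 𝔸] in
/-- a `P`-periodic field is fixed by the shift `t_{P•n}`. [cite: Balaban1985RegularSpaces, p.77 («Ω_j = T_η»)] -/
theorem shiftCfg_eq_self_of_isPeriodic {P : ℕ} {β : Type*} {F : Site d → β} (hF : IsPeriodic P F) (n : Site d) :
    shiftCfg ((P : ℤ) • n) F = F := funext fun y => hF y n

omit [CStarAlgebra 𝔸] in
/-- the single-bond bump moves with the shift: `t_v(δ_{(y+v, μ)}X) = δ_{(y, μ)}X`. [cite: Balaban1985Averaging, (137)–(138) p.39 (bookkeeping)] -/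
theorem shiftCfg_bump {𝔸 : Type*} [NormedRing 𝔸] (v y : Site d) (μ : Fin d) (X : 𝔸) : shiftCfg v (bump (y + v) μ X) = bump y μ X := by
  funext x κ
  simp only [shiftCfg_apply, bump, add_left_inj]

/-- `t_v(iηA) = iη(t_vA)`. [cite: Balaban1985RegularSpaces, (1.41) p.83 (bookkeeping)] -/
theorem iEta_shiftCfg (η : ℝ) (v : Site d) (A : Site d → Fin d → 𝔸) : shiftCfg v (iEta η A) = iEta η (shiftCfg v A) := rfl

/-- `iηA` of a periodic `A` is periodic. [cite: Balaban1985RegularSpaces, (1.41) p.83, p.77] -/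
theorem isPeriodic_iEta {P : ℕ} (η : ℝ) {A : Site d → Fin d → 𝔸} (hA : IsPeriodic P A) : IsPeriodic P (iEta η A) := fun y n => by
  funext κ
  simp only [iEta, show A (y + (P : ℤ) • n) = A y from hA y n]

omit [CStarAlgebra 𝔸] in
/-- **THE WINDOW BASE OF THE TRANSPOSE MOVES BY `Q•n` WHEN THE FINE SITE MOVES BY `(Lʲ·Q)•n`** (integer division by `Lʲ`, `L ≥ 1`).
[cite: Balaban1985Averaging, p.24 (after (43)), (141) p.39 (the window of a bond; bookkeeping)] -/
theorem winBase_add_pow_mul_smul {L : ℕ} (hL : 1 ≤ L) (j : ℕ) (Q : ℤ) (y n : Site d) (κ : Fin d) (t : Fin 2) :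
    winBase L j (y + ((L : ℤ) ^ j * Q) • n) κ t = winBase L j y κ t + Q • n := by
  funext i
  have hLj : ((L : ℤ) ^ j) ≠ 0 := pow_ne_zero _ (by exact_mod_cast (show L ≠ 0 by omega))
  simp only [winBase, Pi.add_apply, Pi.smul_apply, smul_eq_mul]
  rw [show y i + (L : ℤ) ^ j * Q * n i = y i + Q * n i * (L : ℤ) ^ j by ring, Int.add_mul_ediv_right _ _ hLj]
  ring

variable {P : ℕ} {L : ℕ} {U₀ : Site d → Fin d → 𝔸ˣ}

/-- ★ **`LʲηQ_j(U₀)B` AT PERIODIC DATA IS `Q`-PERIODIC IN ITS COARSE SITE** when `P = Lʲ·Q` ([B7] (150): translation covariance of the composite linear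
parts, `B7TranslationCovariance.linCovIter_shiftCfg`). [cite: Balaban1985Averaging, (127) p.37, (150) p.40; Balaban1985RegularSpaces, p.77] -/
theorem linCovIter_add_period (hU : IsPeriodic P U₀) {B : Site d → Fin d → 𝔸} (hB : IsPeriodic P B) {j : ℕ} {Q : ℤ}
    (hP : (P : ℤ) = (L : ℤ) ^ j * Q) (z n : Site d) (κ : Fin d) :
    linCovIter L U₀ B j (z + Q • n) κ = linCovIter L U₀ B j z κ := by
  rw [linCovIter_shiftCfg L U₀ B j (Q • n) z κ, smul_smul, ← hP, shiftCfg_eq_self_of_isPeriodic hU, shiftCfg_eq_self_of_isPeriodic hB]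

variable (τ : 𝔸 →ₗ[ℂ] ℂ) [FiniteDimensional ℝ 𝔸]

/-- ★ **THE TRANSPOSE `Q_jᵀ` IS `(Lʲ·Q)`-TRANSLATION INVARIANT ON `Q`-PERIODIC COARSE INPUTS** at a periodic background (`P = Lʲ·Q`, `L ≥ 1`): the columns
of (147) at the bump `δ_{(y + P•n, μ)}` over the windows of `y + P•n` are the columns at `δ_{(y, μ)}` over the windows of `y`.
[cite: Balaban1985Averaging, (127) p.37, (147), (150) p.40; Balaban1985BackgroundPropagators, (3.16) p.393; Balaban1985RegularSpaces, p.77] -/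
theorem linCovIterT_add_period (hL : 1 ≤ L) (hU : IsPeriodic P U₀) {j : ℕ} {Q : ℕ} (hP : (P : ℤ) = (L : ℤ) ^ j * Q)
    {F : Site d → Fin d → 𝔸} (hF : IsPeriodic Q F) (y n : Site d) (μ : Fin d) :
    linCovIterT τ L U₀ j F (y + (P : ℤ) • n) μ = linCovIterT τ L U₀ j F y μ := by
  unfold linCovIterT
  refine Finset.sum_congr rfl fun κ _ => Finset.sum_congr rfl fun t _ => ?_
  have hw : winBase L j (y + (P : ℤ) • n) κ t = winBase L j y κ t + (Q : ℤ) • n := by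
    rw [hP]; exact winBase_add_pow_mul_smul hL j (Q : ℤ) y n κ t
  have hE : (fun X => linCovIter L U₀ (bump (y + (P : ℤ) • n) μ X) j (winBase L j (y + (P : ℤ) • n) κ t) κ) =
      fun X => linCovIter L U₀ (bump y μ X) j (winBase L j y κ t) κ := by
    funext X
    rw [hw, linCovIter_shiftCfg L U₀ _ j ((Q : ℤ) • n) _ κ, smul_smul, ← hP, shiftCfg_eq_self_of_isPeriodic hU, shiftCfg_bump]
  rw [hE, hw, show F (winBase L j y κ t + (Q : ℤ) • n) κ = F (winBase L j y κ t) κ from congrFun (hF _ n) κ]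

omit [FiniteDimensional ℝ 𝔸] in
/-- ★ **THE LEVEL-`j` INPUT `𝟙_{Λ_j}·(LʲηQ_j(U₀)A)` IS `Q`-PERIODIC** for periodic data and a class `Λ_j = ΛbP m j` with `Q`-periodic `κ`-sections (`P = Lʲ·Q`).
[cite: Balaban1985BackgroundPropagators, (3.16) p.393; Balaban1985RegularSpaces, (1.56) p.86, p.77] -/
theorem isPeriodic_clsField (hU : IsPeriodic P U₀) {A : Site d → Fin d → 𝔸} (hA : IsPeriodic P A) {ΛbP : ℕ → ℕ → Set (Site d × Fin d)}
    (η : ℝ) {m j : ℕ} {Q : ℕ} (hP : (P : ℤ) = (L : ℤ) ^ j * Q) (hΛ : ∀ κ : Fin d, IsPeriodic Q (fun z => (z, κ) ∈ ΛbP m j)) :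
    IsPeriodic Q (clsField L ΛbP η m j U₀ A) := fun z n => by
  funext κ
  have hmem : ((z + (Q : ℤ) • n, κ) ∈ ΛbP m j) = ((z, κ) ∈ ΛbP m j) := hΛ κ z n
  have hlin : linCovIter L U₀ (iEta η A) j (z + (Q : ℤ) • n) κ = linCovIter L U₀ (iEta η A) j z κ :=
    linCovIter_add_period hU (isPeriodic_iEta η hA) hP z n κ
  unfold clsField
  by_cases h : (z, κ) ∈ ΛbP m j
  · rw [if_pos (hmem ▸ h), if_pos h, hlin]
  · rw [if_neg (fun h' => h (hmem ▸ h')), if_neg h]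

/-- ★★ **THE GENUINE `Q*aQ(U₀)` OF (3.16) (EDITION P) IS `P`-TRANSLATION INVARIANT AT PERIODIC DATA**: `L ≥ 1`, `U₀`, `A` `P`-periodic, `Lᵐ ∣ P`, and the
level-`j` class `ΛbP m j` with `(P ∕ Lʲ)`-periodic `κ`-sections for `j ≤ m` (dag-n05-w2's `IdxB8SubD.isPeriodic_Λb_of_dvd` currency) ⟹
`(Q*aQ(U₀)A)(⟨y + P•n, ·⟩) = (Q*aQ(U₀)A)(⟨y, ·⟩)`; the guard (1.7) reads `U₀` only. [cite: Balaban1985BackgroundPropagators, (3.16) p.393, (3.26) p.395; Balaban1985RegularSpaces, (1.56), (1.58) p.86, (1.7) p.77, p.77 («Ω_j = T_η»); Balaban1985Averaging, (127) p.37, (150) p.40] -/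
theorem QQZdP_add_period (hL : 1 ≤ L) (hU : IsPeriodic P U₀) {A : Site d → Fin d → 𝔸} (hA : IsPeriodic P A)
    (ΛbP : ℕ → ℕ → Set (Site d × Fin d)) (i : ZdIdx d L) {m : ℕ} (hdvd : L ^ m ∣ P)
    (hΛ : ∀ j, j ≤ m → ∀ κ : Fin d, IsPeriodic (P / L ^ j) (fun z => (z, κ) ∈ ΛbP m j)) (y n : Site d) (μ : Fin d) :
    QQZdP τ L ΛbP i m U₀ A (y + (P : ℤ) • n) μ = QQZdP τ L ΛbP i m U₀ A y μ := by
  unfold QQZdP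
  split_ifs with h
  · refine Finset.sum_congr rfl fun j hj => ?_
    have hjm : j ≤ m := Nat.lt_succ_iff.mp (Finset.mem_range.mp hj)
    have hP : (P : ℤ) = (L : ℤ) ^ j * ((P / L ^ j : ℕ) : ℤ) := by
      exact_mod_cast (Nat.mul_div_cancel' ((pow_dvd_pow L hjm).trans hdvd)).symm
    rw [linCovIterT_add_period τ hL hU hP (isPeriodic_clsField hU hA i.η hP (hΛ j hjm)) y n μ]
  · rfl

/-- ★★ **`Q*aQ(U₀)A` OF PERIODIC DATA IS PERIODIC** (same hypotheses). [cite: Balaban1985BackgroundPropagators, (3.16) p.393; Balaban1985RegularSpaces, (1.56) p.86, p.77 («Ω_j = T_η»)] -/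
theorem isPeriodic_QQZdP (hL : 1 ≤ L) (hU : IsPeriodic P U₀) {A : Site d → Fin d → 𝔸} (hA : IsPeriodic P A)
    (ΛbP : ℕ → ℕ → Set (Site d × Fin d)) (i : ZdIdx d L) {m : ℕ} (hdvd : L ^ m ∣ P)
    (hΛ : ∀ j, j ≤ m → ∀ κ : Fin d, IsPeriodic (P / L ^ j) (fun z => (z, κ) ∈ ΛbP m j)) :
    IsPeriodic P (QQZdP τ L ΛbP i m U₀ A) := fun y n => funext fun μ => QQZdP_add_period τ hL hU hA ΛbP i hdvd hΛ y n μ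

/-- ★ **`Q*aQ(U₀)` MAPS `E_𝔤^per(P)` INTO ITSELF** (`L ≥ 2`, faithful Hermitian tracial `τ`, periodic unitary `U₀`, `Lᵐ ∣ P`, periodic class sections, and
[B8] (1.31)'s box law at levels `j ≥ 1`: the box of a class bond lies in `Ω_{j−1}`): periodicity above; Hermiticity = dag-n06-w2∕w-lineage's
`B9Eq326DeltaAHermitianZdCurved.isSelfAdjoint_QQZdP_of_box`. [cite: Balaban1985BackgroundPropagators, (3.16) p.393, p.391; Balaban1985RegularSpaces, (1.31) p.82, (1.7) p.77, p.77] -/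
theorem QQZdP_mem_domSubHPer [Nontrivial 𝔸] (hL : 2 ≤ L) (hτp : ∀ a : 𝔸, a ≠ 0 → 0 < (τ (star a * a)).re)
    (hτt : ∀ a b : 𝔸, τ (a * b) = τ (b * a)) (hτs : ∀ a : 𝔸, τ (star a) = starRingEnd ℂ (τ a))
    (hUu : ∀ (x : Site d) (κ : Fin d), U₀ x κ ∈ unitaryUnits 𝔸) (hU : IsPeriodic P U₀)
    (ΛbP : ℕ → ℕ → Set (Site d × Fin d)) (i : ZdIdx d L) {m : ℕ} (hdvd : L ^ m ∣ P)
    (hΛ : ∀ j, j ≤ m → ∀ κ : Fin d, IsPeriodic (P / L ^ j) (fun z => (z, κ) ∈ ΛbP m j))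
    (hbox : ∀ j, 1 ≤ j → j ≤ m → ∀ c ∈ ΛbP m j, ∀ x, InBox (loK L j c.1) (bondHiK L j c.1 c.2) x → x ∈ i.Ω (j - 1))
    {A : Site d → Fin d → 𝔸} (hA : A ∈ domSubHPer (d := d) (𝔸 := 𝔸) P) :
    QQZdP τ L ΛbP i m U₀ A ∈ domSubHPer (d := d) (𝔸 := 𝔸) P :=
  ⟨isPeriodic_QQZdP τ (le_trans (by norm_num) hL) hU hA.1 ΛbP i hdvd hΛ,
    fun y μ => isSelfAdjoint_QQZdP_of_box τ hL hτp hτt hτs hbox hUu hA.2 y μ⟩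

end Averaging

/-! ## §3  Assembly: a record with the genuine `Δ′`, `Q*aQ` and a periodic-preserving `DRD*` letter preserves `E_𝔤^per(P)` -/

section Assembly

variable {d : ℕ} {𝔸 : Type*} [CStarAlgebra 𝔸] {P : ℕ}

/-- **THE `D*D` PART MAPS `E_𝔤^per(P)` INTO ITSELF** at a periodic unitary background (FILE 1's `isPeriodic_Jcur` + `star_Jcur`).
[cite: Balaban1985BackgroundPropagators, (3.10) p.392, p.391; Balaban1985RegularSpaces, (1.55) p.86, p.77] -/
theorem Jcur_mem_domSubHPer (η : ℝ) {U₀ : Site d → Fin d → 𝔸ˣ} (hUu : ∀ (x : Site d) (κ : Fin d), U₀ x κ ∈ unitaryUnits 𝔸)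
    (hU : IsPeriodic P U₀) {A : Site d → Fin d → 𝔸} (hA : A ∈ domSubHPer (d := d) (𝔸 := 𝔸) P) :
    (fun x κ => Jcur η U₀ A κ x) ∈ domSubHPer (d := d) (𝔸 := 𝔸) P := by
  refine ⟨isPeriodic_Jcur η hU hA.1, fun y τ' => ?_⟩
  have hstarA : star A = A := by
    funext z κ; exact (hA.2 z κ).star_eq
  rw [IsSelfAdjoint, star_Jcur hUu A τ' y, hstarA]

/-- ★ **`PerPreservingAt` FROM THE THREE LETTERS** (ANY record `o`): if `Dp`, `DRDs`, `QQ` each map `E_𝔤^per(P)` into itself at a periodic unitary `U₀`, so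
does `Δ_a(U₀) = D*D + Dp + DRDs + QQ` ((3.26) with (3.10)). [cite: Balaban1985BackgroundPropagators, (3.26) p.395, (3.10) p.392; Balaban1985RegularSpaces, p.77 («Ω_j = T_η»)] -/
theorem perPreservingAt_of_letters (η : ℝ) (o : OpsZd d 𝔸) {U₀ : Site d → Fin d → 𝔸ˣ} (hUu : ∀ (x : Site d) (κ : Fin d), U₀ x κ ∈ unitaryUnits 𝔸)
    (hU : IsPeriodic P U₀)
    (hDp : ∀ A ∈ domSubHPer (d := d) (𝔸 := 𝔸) P, o.Dp U₀ A ∈ domSubHPer (d := d) (𝔸 := 𝔸) P)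
    (hDRDs : ∀ A ∈ domSubHPer (d := d) (𝔸 := 𝔸) P, o.DRDs U₀ A ∈ domSubHPer (d := d) (𝔸 := 𝔸) P)
    (hQQ : ∀ A ∈ domSubHPer (d := d) (𝔸 := 𝔸) P, o.QQ U₀ A ∈ domSubHPer (d := d) (𝔸 := 𝔸) P) :
    PerPreservingAt η o P U₀ := by
  intro A hA
  have h : deltaAOf η o U₀ A = (fun x κ => Jcur η U₀ A κ x) + o.Dp U₀ A + o.DRDs U₀ A + o.QQ U₀ A := by
    funext x κ; rfl
  rw [h]
  exact Submodule.add_mem _ (Submodule.add_mem _ (Submodule.add_mem _ (Jcur_mem_domSubHPer η hUu hU hA) (hDp A hA)) (hDRDs A hA)) (hQQ A hA)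

variable (τ : 𝔸 →ₗ[ℂ] ℂ) [FiniteDimensional ℝ 𝔸] {L : ℕ}

/-- ★★ **A RECORD WITH THE GENUINE `Δ′` AND `Q*aQ` PRESERVES `E_𝔤^per(P)`, GIVEN THE SAME FOR ITS `DRD*` LETTER** — at the member `(M, i, m)` of the
(β′-PERIODIC) road: `o.Dp = DpZd i.η`, `o.QQ = QQZdP τ L ΛbP i m` (e.g. `withDpZd (withQQP τ L ΛbP ops₀) M i m`, or `opsAllZd τ L ΛbP ops₀ M i m` by
`opsAllZd_Dp ∕ opsAllZd_QQ`), `L ≥ 2`, faithful Hermitian tracial `τ`, periodic unitary `U₀`, `Lᵐ ∣ P`, periodic class sections, box law at `j ≥ 1`.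
[cite: Balaban1985BackgroundPropagators, (3.26) p.395, (3.10) p.392, (3.16) p.393; Balaban1985RegularSpaces, (1.31) p.82, (1.58) p.86, p.77 («Ω_j = T_η»)] -/
theorem perPreservingAt_of_DpZd_QQZdP [Nontrivial 𝔸] (hL : 2 ≤ L) (hτp : ∀ a : 𝔸, a ≠ 0 → 0 < (τ (star a * a)).re)
    (hτt : ∀ a b : 𝔸, τ (a * b) = τ (b * a)) (hτs : ∀ a : 𝔸, τ (star a) = starRingEnd ℂ (τ a))
    (ΛbP : ℕ → ℕ → Set (Site d × Fin d)) (i : ZdIdx d L) {m : ℕ} (o : OpsZd d 𝔸)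
    (hoDp : o.Dp = DpZd i.η) (hoQQ : o.QQ = QQZdP τ L ΛbP i m)
    {U₀ : Site d → Fin d → 𝔸ˣ} (hUu : ∀ (x : Site d) (κ : Fin d), U₀ x κ ∈ unitaryUnits 𝔸) (hU : IsPeriodic P U₀) (hdvd : L ^ m ∣ P)
    (hΛ : ∀ j, j ≤ m → ∀ κ : Fin d, IsPeriodic (P / L ^ j) (fun z => (z, κ) ∈ ΛbP m j))
    (hbox : ∀ j, 1 ≤ j → j ≤ m → ∀ c ∈ ΛbP m j, ∀ x, InBox (loK L j c.1) (bondHiK L j c.1 c.2) x → x ∈ i.Ω (j - 1))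
    (hDRDs : ∀ A ∈ domSubHPer (d := d) (𝔸 := 𝔸) P, o.DRDs U₀ A ∈ domSubHPer (d := d) (𝔸 := 𝔸) P) :
    PerPreservingAt i.η o P U₀ :=
  perPreservingAt_of_letters i.η o hUu hU
    (fun A hA => by rw [hoDp]; exact DpZd_mem_domSubHPer i.η hUu hU hA)
    hDRDs
    (fun A hA => by rw [hoQQ]; exact QQZdP_mem_domSubHPer τ hL hτp hτt hτs hUu hU ΛbP i hdvd hΛ hbox hA)

/-- **THE RECORD-EDIT READING**: `withDpZd (withQQP τ L ΛbP ops₀) M i m` (the genuine `Δ′` and `Q*aQ` over ANY `ops₀`) preserves `E_𝔤^per(P)` at every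
periodic unitary `U₀` of the member, given the same for `ops₀`'s `DRDs` letter. [cite: Balaban1985BackgroundPropagators, (3.26) p.395, (3.10) p.392, (3.16) p.393; Balaban1985RegularSpaces, p.77] -/
theorem perPreservingAt_withDpZd_withQQP_of_DRDs [Nontrivial 𝔸] (hL : 2 ≤ L) (hτp : ∀ a : 𝔸, a ≠ 0 → 0 < (τ (star a * a)).re)
    (hτt : ∀ a b : 𝔸, τ (a * b) = τ (b * a)) (hτs : ∀ a : 𝔸, τ (star a) = starRingEnd ℂ (τ a))
    (ΛbP : ℕ → ℕ → Set (Site d × Fin d)) (ops₀ : ℝ → ZdIdx d L → ℕ → OpsZd d 𝔸) (M : ℝ) (i : ZdIdx d L) {m : ℕ}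
    {U₀ : Site d → Fin d → 𝔸ˣ} (hUu : ∀ (x : Site d) (κ : Fin d), U₀ x κ ∈ unitaryUnits 𝔸) (hU : IsPeriodic P U₀) (hdvd : L ^ m ∣ P)
    (hΛ : ∀ j, j ≤ m → ∀ κ : Fin d, IsPeriodic (P / L ^ j) (fun z => (z, κ) ∈ ΛbP m j))
    (hbox : ∀ j, 1 ≤ j → j ≤ m → ∀ c ∈ ΛbP m j, ∀ x, InBox (loK L j c.1) (bondHiK L j c.1 c.2) x → x ∈ i.Ω (j - 1))
    (hDRDs : ∀ A ∈ domSubHPer (d := d) (𝔸 := 𝔸) P, (ops₀ M i m).DRDs U₀ A ∈ domSubHPer (d := d) (𝔸 := 𝔸) P) :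
    PerPreservingAt i.η (withDpZd (withQQP τ L ΛbP ops₀) M i m) P U₀ :=
  perPreservingAt_of_DpZd_QQZdP τ hL hτp hτt hτs ΛbP i (withDpZd (withQQP τ L ΛbP ops₀) M i m) rfl rfl hUu hU hdvd hΛ hbox hDRDs

end Assembly

end Literature.MathematicalPhysics.QuantumFieldTheory.Balaban1983to89.B9Eq326DeltaAPeriodicLettersZd

end
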